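import Literature.IUT.LogThetaLattice.DistinctCollectionsOfKitsBiTagged
import Literature.IUT.LogThetaLattice.ThetaLinkOfKitsToy
import HarnessLib

/-!
# The generic bi-tagging theorem INSTANTIATED at abc-iut-L5-t4's toy kit datum: its ten binders are jointly satisfiable

Mochizuki, *Inter-universal Teichmüller Theory III*, kurims manuscript (May 2020), Def 1.4 p. 45, Prop 1.2 (x) p. 34; *II* (Dec 2020)
Cor 4.10 (vi) p. 161. PROOF-ONLY companion (no `def`) of this seat's `DistinctCollectionsOfKitsBiTagged.lean` (abc-iut-w5-d043, L6 NV row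
«NV-W2 IUTchIII:Def1.4», part W2d): the generic theorem `distinctCollections_ofKits_biTag` quantifies over a kit datum
`(FK, L, hbij, hsurj, hR, X, TK, LK)`, a theater `H₀` and a place `v₀`; here all ten binders are SUPPLIED at once by the toy kit of record —
abc-iut-L5-t4's `FKit.toy` / abc-iut-L5-d4's `MonoLaws.toy`, `isomFtoDBijective_toy`, `isomFmtoDmSurjective_toy`, `rlfOfIsStrip_toy` /
abc-iut-L6-t3's `KitsToy.timesMuSide`, `KitsToy.logKit`, `KitsToy.thetaPMEllHT` / abc-iut-w5-d132's `KitsToy.thetaLinkKit` / the one place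
`()` — so the three «distinct collection» interfaces of [IUTchIII] Def 1.4, Prop 1.2 (x) and [IUTchII] Cor 4.10 (vi) are jointly inhabited
at the frame assembled from the BI-TAGGED TOY KIT `(FKit.toy l hl).biTag`, with NO binder left. HONEST LABEL (abc-iut-L6-lead §F v1.19j (1)):
relabelled copies of ONE toy theater; consistency ≠ endorsement; nothing here bears on the real-kit line (abc-iut-L5-t4); no side taken on
[IUTchIII] Cor 3.12. [claim: Mochizuki2012, status: disputed]
-/

namespace Literature.IUT.LogThetaLattice

open CategoryTheory
open Literature.IUT.HodgeArakelov Literature.IUT.HodgeTheaters Literature.IUT.HodgeTheaters.PMBaseKit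

namespace KitsToy

variable (l : ℕ) [Fact l.Prime] (hl : l ≠ 2)

/-- **IUTchIII:Def1.4** (kurims p.45) **All three «distinct collection» interfaces at the bi-tagged TOY kit frame, no binder left**: the
generic `distinctCollections_ofKits_biTag` at the toy kit datum of record (theater `KitsToy.thetaPMEllHT`, place `()`).
[claim: Mochizuki2012, status: disputed] -/
theorem distinctCollections_biTag (kind : LatticeKind) :
    Nonempty (LogThetaLatticeDiagram
        (logStripDataBiTag (FKit.MonoLaws.toy l hl) (FKit.isomFtoDBijective_toy l hl) (FKit.isomFmtoDmSurjective_toy l hl)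
          (FKit.rlfOfIsStrip_toy l hl) (KitsToy.timesMuSide l hl) (KitsToy.logKit l hl))
        (thetaLinkDataBiTag (FKit.MonoLaws.toy l hl) (FKit.isomFtoDBijective_toy l hl) (FKit.isomFmtoDmSurjective_toy l hl)
          (FKit.rlfOfIsStrip_toy l hl) (KitsToy.timesMuSide l hl) (KitsToy.thetaLinkKit l hl))) ∧
      Nonempty (FrobeniusChain (StripFrame.ofKitsBiTag (FKit.MonoLaws.toy l hl) (FKit.isomFtoDBijective_toy l hl)
        (FKit.isomFmtoDmSurjective_toy l hl) (FKit.rlfOfIsStrip_toy l hl) (KitsToy.timesMuSide l hl))) ∧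
        Nonempty (ThetaGauChain (ThetaLinkSetting.ofStripFrame
          (StripFrame.ofKitsBiTag (FKit.MonoLaws.toy l hl) (FKit.isomFtoDBijective_toy l hl)
            (FKit.isomFmtoDmSurjective_toy l hl) (FKit.rlfOfIsStrip_toy l hl) (KitsToy.timesMuSide l hl)))) :=
  distinctCollections_ofKits_biTag (FKit.MonoLaws.toy l hl) (FKit.isomFtoDBijective_toy l hl)
    (FKit.isomFmtoDmSurjective_toy l hl) (FKit.rlfOfIsStrip_toy l hl) (KitsToy.timesMuSide l hl) (KitsToy.thetaLinkKit l hl)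
    (KitsToy.logKit l hl) kind () (KitsToy.thetaPMEllHT l hl)

/-- **IUTchII:Cor4.10(vi)** (kurims p.161) CONTRAST at the same base kit: the UNTAGGED toy frame carries neither a Frobenius-picture chain
(abc-iut-w5-d005's `KitsToy.isEmpty_frobeniusChain`) nor — by tagging only — does it need to: the bi-tagged toy frame carries both chains.
[claim: Mochizuki2012, status: disputed] -/
theorem frobeniusChain_untagged_vs_biTagged :
    IsEmpty (FrobeniusChain (KitsToy.frame l hl)) ∧
      Nonempty (FrobeniusChain (StripFrame.ofKitsBiTag (FKit.MonoLaws.toy l hl) (FKit.isomFtoDBijective_toy l hl)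
        (FKit.isomFmtoDmSurjective_toy l hl) (FKit.rlfOfIsStrip_toy l hl) (KitsToy.timesMuSide l hl))) :=
  ⟨KitsToy.isEmpty_frobeniusChain l hl, (distinctCollections_biTag l hl LatticeKind.gaussian).2.1⟩

end KitsToy

end Literature.IUT.LogThetaLattice
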